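import Mathlib.Algebra.Order.Chebyshev
import Mathlib.Analysis.SpecialFunctions.Pow.Real
import Mathlib.Data.ZMod.Basic
import Literature.Computability.AlgebraicComplexity.PrattTrapezoidVal
import HarnessLib

/-!
# Pratt 2024, §3: the trivial upper bound for `Val(G)` and super-multiplicativity (proved)

K. Pratt, *On generalized corners and matrix multiplication*, ITCS 2024 (LIPIcs 287, 89),
arXiv:2309.03878 [Pratt2024], §3 (Def. 3.2, Props. 3.1, 3.4, 3.5), read in the held arXiv text
(pp. 4, 7).  This file only PROVES facts about the notions already vendored in
`Literature/Computability/AlgebraicComplexity/PrattTrapezoidVal.lean`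
(`IsEquilateralTrapezoidFree`, `zeroSumTriples`, `prattVal` = Pratt's `Val(G)`); it introduces no
definition and no named fact.  Written for the definition request `defn-addVal` (route
MatrixMultiplication/EisensteinValCertificates, items `TrapezoidCountBound`,
`PrimeValSaving`, …), whose notion `addVal` **is** `prattVal`.

* `IsEquilateralTrapezoidFree.card_zeroSumTriples_sq_le` — **Prop. 3.1** in the sharpened
  counting form used by the route (`TrapezoidCountBound`): for an equilateral trapezoid-free
  triple, `(#solutions of a+b+c=0 in A×B×C)² ≤ #A · #B · #C`.  Proof as printed (p. 7): for
  `a ∈ A` let `d_a` be the number of solutions through `a`; the pairs `(b, c)` formed from two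
  solutions `(a,b,·)`, `(a,·,c)` through the same `a` are pairwise distinct across all `a`
  (two such pairs coinciding would give two solutions of the third system `a+b'+c = 0 = a+b+c'`),
  so `∑ d_a² ≤ #B·#C`, and Cauchy–Schwarz gives `(∑ d_a)² ≤ #A ∑ d_a²`.  Only the third clause of
  Def. 3.2 is used, and commutativity is not needed.
* `prattVal_sq_le_card_pow_three`, `prattVal_le_card_rpow` — **Prop. 3.4, upper bound**:
  `Val(G)² ≤ |G|³`, i.e. `Val(G) ≤ |G|^{3/2}` (the lower bound `|G| ≤ Val(G)` is
  `card_le_prattVal` in the base file).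
* `IsEquilateralTrapezoidFree.product`, `card_zeroSumTriples_product`,
  `prattVal_mul_le_prattVal_prod` — **Prop. 3.5** (super-multiplicativity):
  products of trapezoid-free triples are trapezoid-free in `G × H`, the solution count is
  multiplicative, hence `Val(G)·Val(H) ≤ Val(G × H)`.
* `IsEquilateralTrapezoidFree.image`, `card_zeroSumTriples_image`, `prattVal_congr` —
  transport along an additive isomorphism [folklore]; with the Chinese remainder theorem
  (`ZMod.chineseRemainder`), `prattVal_zmod_mul_le`: `Val(ℤ/m)·Val(ℤ/n) ≤ Val(ℤ/mn)` for coprime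
  `m, n` (the form in which Prop. 3.5 is used for cyclic groups).

Not here: Prop. 3.3 (STPP lower bound; route item `STPPGivesVal`), Prop. 3.6, Thm. 3.7, §4.
-/

namespace Literature.Computability.AlgebraicComplexity

open Finset

/-! ### Proposition 3.1 / 3.4: the counting bound -/

section CountBound

variable {G : Type*} [AddGroup G] [DecidableEq G]

/-- **Pratt 2024, Prop. 3.1 (counting form)**: if `(A, B, C)` is equilateral trapezoid-free then
the number `m` of solutions of `a + b + c = 0` in `A × B × C` satisfies `m² ≤ #A · #B · #C`
(printed for parts of equal size `N` as `m ≤ N^{3/2}`; the proof gives this).  Only the third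
system of Def. 3.2 (fixed `b' ∈ B`, `c' ∈ C`) is used. [cite: Pratt2024, Prop. 3.1 and its proof] -/
theorem IsEquilateralTrapezoidFree.card_zeroSumTriples_sq_le {A B C : Finset G}
    (h : IsEquilateralTrapezoidFree A B C) :
    #(zeroSumTriples A B C) ^ 2 ≤ #A * #B * #C := by
  set Z := zeroSumTriples A B C with hZ
  have hmemZ : ∀ {t : G × G × G}, t ∈ Z →
      (t.1 ∈ A ∧ t.2.1 ∈ B ∧ t.2.2 ∈ C) ∧ t.1 + t.2.1 + t.2.2 = 0 :=
    fun ht => mem_zeroSumTriples.1 ht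
  -- `m = ∑_{a ∈ A} d_a`, `d_a` = number of solutions with first coordinate `a`
  have hmaps : Set.MapsTo (fun t : G × G × G => t.1) (Z : Set (G × G × G)) (A : Set G) :=
    fun t ht => Finset.mem_coe.2 (hmemZ (Finset.mem_coe.1 ht)).1.1
  have hcard : #Z = ∑ a ∈ A, #(Z.filter fun t => t.1 = a) := card_eq_sum_card_fiberwise hmaps
  -- pairs of solutions through the same `a`: there are `∑ d_a²` of them
  set P := (Z ×ˢ Z).filter fun q : (G × G × G) × (G × G × G) => q.1.1 = q.2.1 with hP
  have hPcard : #P = ∑ a ∈ A, #(Z.filter fun t => t.1 = a) ^ 2 := by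
    have hmapsP : Set.MapsTo (fun q : (G × G × G) × (G × G × G) => q.1.1) (P : Set _)
        (A : Set G) := fun q hq =>
      hmaps (Finset.mem_coe.2 (mem_product.1 (mem_filter.1 (Finset.mem_coe.1 hq)).1).1)
    rw [card_eq_sum_card_fiberwise hmapsP]
    refine sum_congr rfl fun a _ => ?_
    rw [sq, ← card_product]
    congr 1
    ext q
    simp only [hP, mem_filter, mem_product]
    constructor
    · rintro ⟨⟨⟨h1, h2⟩, h12⟩, ha⟩
      exact ⟨⟨h1, ha⟩, h2, h12.symm.trans ha⟩
    · rintro ⟨⟨h1, ha⟩, h2, ha'⟩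
      exact ⟨⟨⟨h1, h2⟩, ha.trans ha'.symm⟩, ha⟩
  -- these pairs `((a,b,c₁), (a,b₂,c))` have pairwise distinct `(b, c)`, by the third system
  have hPle : #P ≤ #B * #C := by
    rw [← card_product]
    refine card_le_card_of_injOn (fun q : (G × G × G) × (G × G × G) => (q.1.2.1, q.2.2.2)) ?_ ?_
    · intro q hq
      obtain ⟨hq12, -⟩ := mem_filter.1 (Finset.mem_coe.1 hq)
      obtain ⟨h1, h2⟩ := mem_product.1 hq12
      exact Finset.mem_coe.2 (mem_product.2 ⟨(hmemZ h1).1.2.1, (hmemZ h2).1.2.2⟩)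
    · intro q hq q' hq' heq
      obtain ⟨hq12, hqe⟩ := mem_filter.1 (Finset.mem_coe.1 hq)
      obtain ⟨hq1, hq2⟩ := mem_product.1 hq12
      obtain ⟨hq12', hqe'⟩ := mem_filter.1 (Finset.mem_coe.1 hq')
      obtain ⟨hq1', hq2'⟩ := mem_product.1 hq12'
      obtain ⟨hb, hc⟩ := Prod.mk.inj heq
      obtain ⟨⟨ha1, hb1, hc1⟩, hs1⟩ := hmemZ hq1
      obtain ⟨⟨-, hb2, hc2⟩, hs2⟩ := hmemZ hq2
      obtain ⟨⟨ha1', -, hc1'⟩, hs1'⟩ := hmemZ hq1'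
      obtain ⟨⟨-, hb2', -⟩, hs2'⟩ := hmemZ hq2'
      -- both `(q.1.1, q.2.2.1, q.1.2.2)` and its primed version solve the third system with
      -- `b' := q.1.2.1`, `c' := q.2.2.2`
      have key : (q.1.1, q.2.2.1, q.1.2.2) = (q'.1.1, q'.2.2.1, q'.1.2.2) := by
        refine Finset.card_le_one.1 (h.2.2 _ hb1 _ hc2) _ ?_ _ ?_
        · refine mem_filter.2 ⟨mem_product.2 ⟨ha1, mem_product.2 ⟨hb2, hc1⟩⟩, ?_, ?_⟩
          · show q.1.1 + q.1.2.1 + q.1.2.2 = 0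
            exact hs1
          · show q.1.1 + q.2.2.1 + q.2.2.2 = 0
            rw [hqe]
            exact hs2
        · refine mem_filter.2 ⟨mem_product.2 ⟨ha1', mem_product.2 ⟨hb2', hc1'⟩⟩, ?_, ?_⟩
          · show q'.1.1 + q.1.2.1 + q'.1.2.2 = 0
            rw [hb]
            exact hs1'
          · show q'.1.1 + q'.2.2.1 + q.2.2.2 = 0
            rw [hc, hqe']
            exact hs2'
      obtain ⟨ha, hrest⟩ := Prod.mk.inj key
      obtain ⟨hb', hc'⟩ := Prod.mk.inj hrest
      refine Prod.ext (Prod.ext ha (Prod.ext hb hc')) (Prod.ext ?_ (Prod.ext hb' hc))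
      exact hqe.symm.trans (ha.trans hqe')
  calc #Z ^ 2 = (∑ a ∈ A, #(Z.filter fun t => t.1 = a)) ^ 2 := by rw [hcard]
    _ ≤ #A * ∑ a ∈ A, #(Z.filter fun t => t.1 = a) ^ 2 := sq_sum_le_card_mul_sum_sq
    _ = #A * #P := by rw [hPcard]
    _ ≤ #A * (#B * #C) := Nat.mul_le_mul_left _ hPle
    _ = #A * #B * #C := (mul_assoc _ _ _).symm

variable [Fintype G]

/-- **Pratt 2024, Prop. 3.4 (upper bound), integral form**: `Val(G)² ≤ |G|³`.
[cite: Pratt2024, Prop. 3.4] -/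
theorem prattVal_sq_le_card_pow_three : prattVal G ^ 2 ≤ Fintype.card G ^ 3 := by
  obtain ⟨A, B, C, h, hk⟩ := exists_prattVal_eq (G := G)
  rw [← hk]
  calc #(zeroSumTriples A B C) ^ 2 ≤ #A * #B * #C := h.card_zeroSumTriples_sq_le
    _ ≤ Fintype.card G * Fintype.card G * Fintype.card G :=
        Nat.mul_le_mul (Nat.mul_le_mul (card_le_univ A) (card_le_univ B)) (card_le_univ C)
    _ = Fintype.card G ^ 3 := by ring

/-- **Pratt 2024, Prop. 3.4 (upper bound)**: `Val(G) ≤ |G|^{3/2}` for every finite group `G`.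
[cite: Pratt2024, Prop. 3.4] -/
theorem prattVal_le_card_rpow : (prattVal G : ℝ) ≤ (Fintype.card G : ℝ) ^ ((3 : ℝ) / 2) := by
  have h : ((prattVal G : ℝ)) ^ 2 ≤ (Fintype.card G : ℝ) ^ 3 := by
    exact_mod_cast prattVal_sq_le_card_pow_three (G := G)
  have h2 : ((prattVal G : ℝ) ^ 2) ^ ((2 : ℕ) : ℝ)⁻¹ ≤ ((Fintype.card G : ℝ) ^ 3) ^ ((2 : ℕ) : ℝ)⁻¹ :=
    Real.rpow_le_rpow (by positivity) h (by positivity)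
  rw [Real.pow_rpow_inv_natCast (Nat.cast_nonneg _) two_ne_zero] at h2
  refine h2.trans_eq ?_
  rw [← Real.rpow_natCast_mul (Nat.cast_nonneg _)]
  norm_num

end CountBound

/-! ### Proposition 3.5: super-multiplicativity -/

section Product

variable {G H : Type*} [AddGroup G] [DecidableEq G] [AddGroup H] [DecidableEq H]

omit [AddGroup G] [DecidableEq G] [AddGroup H] [DecidableEq H] in
/-- One "at most one solution" clause for a product triple from the two factor clauses: the
solution set injects into the product of the factor solution sets. [cite: Pratt2024, Prop. 3.5] -/
private theorem card_filter_prod_le_one {A B C : Finset G} {A' B' C' : Finset H}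
    {PG : G × G × G → Prop} [DecidablePred PG] {PH : H × H × H → Prop} [DecidablePred PH]
    (hG : #((A ×ˢ B ×ˢ C).filter PG) ≤ 1) (hH : #((A' ×ˢ B' ×ˢ C').filter PH) ≤ 1)
    (P : (G × H) × (G × H) × (G × H) → Prop) [DecidablePred P]
    (hP : ∀ t, P t → PG (t.1.1, t.2.1.1, t.2.2.1) ∧ PH (t.1.2, t.2.1.2, t.2.2.2)) :
    #(((A ×ˢ A') ×ˢ (B ×ˢ B') ×ˢ (C ×ˢ C')).filter P) ≤ 1 := by
  refine (card_le_card_of_injOn (fun t : (G × H) × (G × H) × (G × H) =>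
      ((t.1.1, t.2.1.1, t.2.2.1), (t.1.2, t.2.1.2, t.2.2.2))) ?_ ?_).trans
    ((card_product _ _).trans_le (mul_le_one' hG hH))
  · intro t ht
    obtain ⟨hmem, hPt⟩ := mem_filter.1 (Finset.mem_coe.1 ht)
    simp only [mem_product] at hmem
    obtain ⟨hg, hh⟩ := hP t hPt
    exact Finset.mem_coe.2 (mem_product.2
      ⟨mem_filter.2 ⟨mem_product.2 ⟨hmem.1.1, mem_product.2 ⟨hmem.2.1.1, hmem.2.2.1⟩⟩, hg⟩,
        mem_filter.2 ⟨mem_product.2 ⟨hmem.1.2, mem_product.2 ⟨hmem.2.1.2, hmem.2.2.2⟩⟩, hh⟩⟩)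
  · intro t _ s _ hts
    simp only [Prod.mk.injEq] at hts
    obtain ⟨⟨e1, e2, e3⟩, e4, e5, e6⟩ := hts
    exact Prod.ext (Prod.ext e1 e4) (Prod.ext (Prod.ext e2 e5) (Prod.ext e3 e6))

/-- **Pratt 2024, Prop. 3.5**: if `(A,B,C)` is equilateral trapezoid-free in `G` and `(A',B',C')`
is equilateral trapezoid-free in `H`, then `(A × A', B × B', C × C')` is equilateral
trapezoid-free in `G × H`. [cite: Pratt2024, Prop. 3.5] -/
theorem IsEquilateralTrapezoidFree.product {A B C : Finset G} {A' B' C' : Finset H}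
    (h : IsEquilateralTrapezoidFree A B C) (h' : IsEquilateralTrapezoidFree A' B' C') :
    IsEquilateralTrapezoidFree (A ×ˢ A') (B ×ˢ B') (C ×ˢ C') := by
  obtain ⟨h1, h2, h3⟩ := h
  obtain ⟨h1', h2', h3'⟩ := h'
  refine ⟨fun p hp q hq => ?_, fun p hp q hq => ?_, fun p hp q hq => ?_⟩ <;>
    obtain ⟨hp1, hp2⟩ := mem_product.1 hp <;> obtain ⟨hq1, hq2⟩ := mem_product.1 hq
  · exact card_filter_prod_le_one (h1 _ hp1 _ hq1) (h1' _ hp2 _ hq2) _ fun t ht =>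
      ⟨⟨by simpa using congrArg Prod.fst ht.1, by simpa using congrArg Prod.fst ht.2⟩,
        by simpa using congrArg Prod.snd ht.1, by simpa using congrArg Prod.snd ht.2⟩
  · exact card_filter_prod_le_one (h2 _ hp1 _ hq1) (h2' _ hp2 _ hq2) _ fun t ht =>
      ⟨⟨by simpa using congrArg Prod.fst ht.1, by simpa using congrArg Prod.fst ht.2⟩,
        by simpa using congrArg Prod.snd ht.1, by simpa using congrArg Prod.snd ht.2⟩
  · exact card_filter_prod_le_one (h3 _ hp1 _ hq1) (h3' _ hp2 _ hq2) _ fun t ht =>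
      ⟨⟨by simpa using congrArg Prod.fst ht.1, by simpa using congrArg Prod.fst ht.2⟩,
        by simpa using congrArg Prod.snd ht.1, by simpa using congrArg Prod.snd ht.2⟩

/-- The solution count is multiplicative on product triples. [cite: Pratt2024, Prop. 3.5] -/
theorem card_zeroSumTriples_product (A B C : Finset G) (A' B' C' : Finset H) :
    #(zeroSumTriples (A ×ˢ A') (B ×ˢ B') (C ×ˢ C')) =
      #(zeroSumTriples A B C) * #(zeroSumTriples A' B' C') := by
  rw [← card_product]
  refine card_bij' (fun t _ => ((t.1.1, t.2.1.1, t.2.2.1), (t.1.2, t.2.1.2, t.2.2.2)))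
    (fun q _ => ((q.1.1, q.2.1), (q.1.2.1, q.2.2.1), (q.1.2.2, q.2.2.2))) ?_ ?_ ?_ ?_
  · intro t ht
    simp only [mem_zeroSumTriples, mem_product, Prod.ext_iff, Prod.fst_add, Prod.snd_add,
      Prod.fst_zero, Prod.snd_zero] at ht ⊢
    tauto
  · intro q hq
    simp only [mem_zeroSumTriples, mem_product, Prod.ext_iff, Prod.fst_add, Prod.snd_add,
      Prod.fst_zero, Prod.snd_zero] at hq ⊢
    tauto
  · intro t _
    rfl
  · intro q _
    rfl

/-- **Pratt 2024, Prop. 3.5 (consequence for `Val`)**: `Val(G) · Val(H) ≤ Val(G × H)`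
("super-multiplicative under direct product", p. 4). [cite: Pratt2024, Prop. 3.5] -/
theorem prattVal_mul_le_prattVal_prod [Fintype G] [Fintype H] :
    prattVal G * prattVal H ≤ prattVal (G × H) := by
  obtain ⟨A, B, C, h, hk⟩ := exists_prattVal_eq (G := G)
  obtain ⟨A', B', C', h', hk'⟩ := exists_prattVal_eq (G := H)
  rw [← hk, ← hk', ← card_zeroSumTriples_product]
  exact card_zeroSumTriples_le_prattVal (h.product h')

end Product

/-! ### Transport along additive isomorphisms; cyclic groups of coprime orders -/

section Equiv

variable {G G' : Type*} [AddGroup G] [DecidableEq G] [AddGroup G'] [DecidableEq G']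

/-- Trapezoid-freeness is transported along an additive isomorphism. [folklore] -/
theorem IsEquilateralTrapezoidFree.image (e : G ≃+ G') {A B C : Finset G}
    (h : IsEquilateralTrapezoidFree A B C) :
    IsEquilateralTrapezoidFree (A.image e) (B.image e) (C.image e) := by
  have key : ∀ {PG : G × G × G → Prop} [DecidablePred PG], #((A ×ˢ B ×ˢ C).filter PG) ≤ 1 →
      ∀ (P' : G' × G' × G' → Prop) [DecidablePred P'],
      (∀ t, P' t → PG (e.symm t.1, e.symm t.2.1, e.symm t.2.2)) →
      #(((A.image e) ×ˢ (B.image e) ×ˢ (C.image e)).filter P') ≤ 1 := by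
    intro PG _ hG P' _ hP
    refine (card_le_card_of_injOn
      (fun t : G' × G' × G' => (e.symm t.1, e.symm t.2.1, e.symm t.2.2)) ?_ ?_).trans hG
    · intro t ht
      obtain ⟨hmem, hPt⟩ := mem_filter.1 (Finset.mem_coe.1 ht)
      simp only [mem_product, mem_image] at hmem
      obtain ⟨⟨a, ha, hae⟩, ⟨b, hb, hbe⟩, ⟨c, hc, hce⟩⟩ := hmem
      refine Finset.mem_coe.2 (mem_filter.2 ⟨mem_product.2 ⟨?_, mem_product.2 ⟨?_, ?_⟩⟩, hP t hPt⟩)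
      · show e.symm t.1 ∈ A
        rw [← hae, e.symm_apply_apply]
        exact ha
      · show e.symm t.2.1 ∈ B
        rw [← hbe, e.symm_apply_apply]
        exact hb
      · show e.symm t.2.2 ∈ C
        rw [← hce, e.symm_apply_apply]
        exact hc
    · intro t _ s _ hts
      simp only [Prod.mk.injEq, EmbeddingLike.apply_eq_iff_eq] at hts
      exact Prod.ext hts.1 (Prod.ext hts.2.1 hts.2.2)
  obtain ⟨h1, h2, h3⟩ := h
  refine ⟨fun x hx y hy => ?_, fun x hx y hy => ?_, fun x hx y hy => ?_⟩ <;>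
    obtain ⟨a, ha, rfl⟩ := mem_image.1 hx <;> obtain ⟨b, hb, rfl⟩ := mem_image.1 hy
  · exact key (h1 a ha b hb) _ fun t ht =>
      ⟨by simpa using congrArg e.symm ht.1, by simpa using congrArg e.symm ht.2⟩
  · exact key (h2 a ha b hb) _ fun t ht =>
      ⟨by simpa using congrArg e.symm ht.1, by simpa using congrArg e.symm ht.2⟩
  · exact key (h3 a ha b hb) _ fun t ht =>
      ⟨by simpa using congrArg e.symm ht.1, by simpa using congrArg e.symm ht.2⟩

/-- The solution count is invariant under an additive isomorphism. [folklore] -/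
theorem card_zeroSumTriples_image (e : G ≃+ G') (A B C : Finset G) :
    #(zeroSumTriples (A.image e) (B.image e) (C.image e)) = #(zeroSumTriples A B C) := by
  have hset : zeroSumTriples (A.image e) (B.image e) (C.image e) =
      (zeroSumTriples A B C).image fun t => (e t.1, e t.2.1, e t.2.2) := by
    ext t
    simp only [mem_zeroSumTriples, mem_image]
    constructor
    · rintro ⟨⟨⟨a, ha, hae⟩, ⟨b, hb, hbe⟩, ⟨c, hc, hce⟩⟩, hsum⟩
      refine ⟨(a, b, c), ⟨⟨ha, hb, hc⟩, ?_⟩, Prod.ext hae (Prod.ext hbe hce)⟩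
      apply e.injective
      rw [map_add, map_add, map_zero]
      show e a + e b + e c = 0
      rw [hae, hbe, hce, hsum]
    · rintro ⟨s, ⟨⟨ha, hb, hc⟩, hsum⟩, rfl⟩
      refine ⟨⟨⟨_, ha, rfl⟩, ⟨_, hb, rfl⟩, ⟨_, hc, rfl⟩⟩, ?_⟩
      show e s.1 + e s.2.1 + e s.2.2 = 0
      rw [← map_add, ← map_add, hsum, map_zero]
  rw [hset, card_image_of_injective]
  intro t s hts
  simp only [Prod.mk.injEq, EmbeddingLike.apply_eq_iff_eq] at hts
  exact Prod.ext hts.1 (Prod.ext hts.2.1 hts.2.2)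

variable [Fintype G] [Fintype G']

/-- `Val` does not decrease along an additive isomorphism. [folklore] -/
theorem prattVal_le_of_addEquiv (e : G ≃+ G') : prattVal G ≤ prattVal G' := by
  obtain ⟨A, B, C, h, hk⟩ := exists_prattVal_eq (G := G)
  rw [← hk, ← card_zeroSumTriples_image e]
  exact card_zeroSumTriples_le_prattVal (h.image e)

/-- `Val` is an isomorphism invariant. [folklore] -/
theorem prattVal_congr (e : G ≃+ G') : prattVal G = prattVal G' :=
  le_antisymm (prattVal_le_of_addEquiv e) (prattVal_le_of_addEquiv e.symm)

end Equiv

/-- **Prop. 3.5 for cyclic groups of coprime orders** (via the Chinese remainder theorem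
`ℤ/mn ≃+ ℤ/m × ℤ/n`): `Val(ℤ/m) · Val(ℤ/n) ≤ Val(ℤ/mn)` for coprime `m, n ≥ 1`.
[cite: Pratt2024, Prop. 3.5] (CRT: [folklore], `ZMod.chineseRemainder`) -/
theorem prattVal_zmod_mul_le {m n : ℕ} [NeZero m] [NeZero n] (hmn : m.Coprime n) :
    prattVal (ZMod m) * prattVal (ZMod n) ≤ prattVal (ZMod (m * n)) := by
  rw [prattVal_congr (ZMod.chineseRemainder hmn).toAddEquiv]
  exact prattVal_mul_le_prattVal_prod

end Literature.Computability.AlgebraicComplexity
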